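import Summits.HubbardSuperconductivity.HubbardSuperconductivity.Theorems.LevyLogBootstrapHalfFilledOrderWindow
import Summits.HubbardSuperconductivity.HubbardSuperconductivity.Theorems.LevyLogBootstrapBlock2InfDivXXZKernelCovariance
import HarnessLib

/-!
# Crux `LevyTransport` (stmt-HubbardSuperconductivity-15049, route `LevyLogBootstrap`), input (a):
# the `M`-uniform ground-state INFRARED BOUND for the transverse kernel of the half-filled XXZ torus

`LevyTransport` (`Block2InfDivXXZ → HalfFilledOrder`) is to be proved by the log-bootstrap of the
line `Cruxes/LevyTransport/Lines/birth.lean`; its load-bearing stub `stub_logBootstrap` consumes four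
inputs, the first of which is **(a) a Gaussian-domination infrared bound, uniform in the side `M`
and in the anisotropy `Δ ∈ [-1, 0]`, for the transverse two-point function of the `S^z_tot = 0`
sector ground state** `ψ` of `H_M(Δ) = xxzHamiltonian 1 (torusGraph 2 M) (-1) Δ`
(`-Σ (SˣSˣ + SʸSʸ + Δ SᶻSᶻ)` on the even torus `(ℤ/Mℤ)²`). This file PROVES input (a), in the
route's own vocabulary (the kernel `K_ψ(x, y) = Re ⟨ψ, S⁺_x S⁻_y ψ⟩`):

* `sectorGS_transverse_infraredBound` — for even `M ≥ 4`, every `Δ ≤ 0`, every normalised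
  `S^z_tot = 0` sector ground state `ψ` and every momentum `q ≠ 0` of the dual torus,
  `0 ≤ K̂_ψ(q)` and `K̂_ψ(q)² · E(q) ≤ 1 - Δ`, where `K̂_ψ(q) = Σ_z cos(q·z) K_ψ(z, 0)` and
  `E(q) = Σᵢ (1 - cos qᵢ)` (`dispersion (latticeMomentum M q)`); i.e. `K̂_ψ(q) ≤ √((1-Δ)/E(q))`,
  the `T = 0` bound `∝ 1/|q|` with an `M`-uniform constant (`≤ √2` on `[-1, 0]`).

The proof is a dictionary onto the Björnberg–Ueltschi reflection-positivity machinery PROVED in the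
tree (`Literature/MathematicalPhysics/QuantumLattice/XYZGroundStateOrder*.lean`):
(1) every ground vector of `H_M(Δ)`, `Δ ≤ 0`, is half filled and the half-filled ground state is
Perron–Frobenius unique (`xxzTorus_groundSpace_eq_span`), so the tracial ground-state functional is
the vector state, `ω₀ = ⟨ψ, · ψ⟩` (`sectorGS_expect_eq_groundStateFunctional`);
(2) `H_M(Δ) = H₃(1,1,Δ)` (`xxzTorus_eq_xyzBondHamiltonian₃`) is invariant under the quarter turn about
the third spin axis and under the half turn about the first, whence
`ω₀(S⁺_x S⁻_y) = 2 ω₀(Sˣ_x Sˣ_y)` (`Infrared.xyz₃_groundStateFunctional_raiseLower`), and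
`Re ω₀(Sˣ_x Sˣ_y)` is Björnberg–Ueltschi's correlation `xyzGroundCorr 0 M 1 1 Δ x y` of the rotated
frame `H' = anisotropicTorus 2 M 1 1 Δ 1` (`re_groundStateFunctional_xx_eq_axisCorr`,
`groundStateAxisCorrTorus_eq_xyzGroundCorr`): `K_ψ = 2·xyzGroundCorr 0`
(`transverseKernel_eq_two_mul_xyzGroundCorr`);
(3) by translation invariance of `K_ψ` (`gs_transverseKernel_eq_sub`) B–U's structure factor is
`xyzStructureFactor M 1 1 Δ q = ½ K̂_ψ(q)` (`xyzStructureFactor_eq_half_transverseHat`);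
(4) ground-state Gaussian domination for `H'` with `J₁ = 1 ≥ 0`, `J₂ = Δ ≤ 0`
(`buSpinHalf_gaussianDomination`, B–U Lemma 5.2 / Cor. 5.3 at `β = ∞`) feeds B–U's Lemma 4.4 at
`β = ∞` (`xyz_infraredBound_of_groundEnergy_le`):
`ĝ_q² E(q) ≤ ¼ Σᵢ ((Δc¹ + c²) - (c¹ + Δc²) cos qᵢ)` with the nearest-neighbour correlations
`|cᵅ| ≤ ¼` of spin ½, hence `≤ (1 - Δ)/4`.

Sources: J. E. Björnberg, D. Ueltschi, *Reflection positivity and infrared bounds for quantum spin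
systems*, in: The Physics and Mathematics of Elliott Lieb I (EMS Press, 2022) 77–108 =
arXiv:2204.12896, Prop. 2.4, Lemma 4.4, Lemma 5.2, Cor. 5.3; T. Kennedy, E. H. Lieb, B. S. Shastry,
J. Stat. Phys. 53 (1988) 1019, eqs. (17)–(19), and Phys. Rev. Lett. 61 (1988) 2582;
F. J. Dyson, E. H. Lieb, B. Simon, J. Stat. Phys. 18 (1978) 335, Thm. 4.2; K. Kubo, T. Kishi,
Phys. Rev. Lett. 61 (1988) 2585 (the XXZ case). No definition is introduced; sorry-free.
-/

noncomputable section

set_option linter.dupNamespace false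

namespace Summit.HubbardSuperconductivity.HubbardSuperconductivity.Theorems.LevyLogBootstrap

open scoped BigOperators Matrix ComplexOrder ComplexConjugate
open Matrix Finset Complex
open Literature.MathematicalPhysics.QuantumLattice Literature.Probability.LatticeModels

namespace Infrared


/-! ### The rotation by `π` about the first spin axis is a symmetry of every `H₃(a,b,c)` -/

section HalfTurn

variable {d : ℕ} (L : ℕ) [NeZero L] (n : ℕ)

/-- **The half-turn frame on the torus**: the product unitary of the rotation by `π` about the first
axis (`Sˣ ↦ Sˣ`, `Sʸ ↦ -Sʸ`, `Sᶻ ↦ -Sᶻ`, `exists_halfTurn_x`) commutes with every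
`H₃(a,b,c)` (the signs cancel on each bond). [cite: BjornbergUeltschi2022, Proposition 2.4] -/
theorem exists_halfTurn_xyzBondHamiltonian₃ (a b c : ℝ) :
    ∃ U : Op (TorusSite d L) (n + 1), U * Uᴴ = 1 ∧ Uᴴ * U = 1 ∧
      U * xyzBondHamiltonian₃ (d := d) L n a b c * Uᴴ = xyzBondHamiltonian₃ L n a b c ∧
      (∀ x, U * siteSpin n x 0 * Uᴴ = siteSpin n x 0) ∧
      (∀ x, U * siteSpin n x 1 * Uᴴ = -siteSpin n x 1) ∧
      (∀ x, U * siteSpin n x 2 * Uᴴ = -siteSpin n x 2) := by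
  obtain ⟨T, hT, hT', hTx, hTy, hTz⟩ := exists_halfTurn_x n
  set U : Op (TorusSite d L) (n + 1) := productOp (fun _ : TorusSite d L => T) with hU
  have hu : ∀ z : TorusSite d L, (fun _ : TorusSite d L => T) z * ((fun _ : TorusSite d L => T) z)ᴴ = 1 :=
    fun _ => hT
  have hu' : ∀ z : TorusSite d L, ((fun _ : TorusSite d L => T) z)ᴴ * (fun _ : TorusSite d L => T) z = 1 :=
    fun _ => hT'
  have h0 : ∀ x : TorusSite d L, U * siteSpin n x 0 * Uᴴ = siteSpin n x 0 := fun x => by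
    rw [hU, productOp_conj_siteSpin hu, spinVec_zero, hTx]
    rfl
  have h1 : ∀ x : TorusSite d L, U * siteSpin n x 1 * Uᴴ = -siteSpin n x 1 := fun x => by
    rw [hU, productOp_conj_siteSpin hu, spinVec_one, hTy, onSite_neg']
    rfl
  have h2 : ∀ x : TorusSite d L, U * siteSpin n x 2 * Uᴴ = -siteSpin n x 2 := fun x => by
    rw [hU, productOp_conj_siteSpin hu, spinVec_two, hTz, onSite_neg']
    rfl
  have hb0 : ∀ x y : TorusSite d L, U * spinBond n 0 x y * Uᴴ = spinBond n 0 x y := fun x y => by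
    rw [hU, productOp_conj_spinBond hu hu', spinVec_zero, hTx, spinBond]
    rfl
  have hb1 : ∀ x y : TorusSite d L, U * spinBond n 1 x y * Uᴴ = spinBond n 1 x y := fun x y => by
    rw [hU, productOp_conj_spinBond hu hu', spinVec_one, hTy, onSite_neg', onSite_neg', neg_mul_neg,
      neg_mul_neg, spinBond]
    rfl
  have hb2 : ∀ x y : TorusSite d L, U * spinBond n 2 x y * Uᴴ = spinBond n 2 x y := fun x y => by
    rw [hU, productOp_conj_spinBond hu hu', spinVec_two, hTz, onSite_neg', onSite_neg', neg_mul_neg,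
      neg_mul_neg, spinBond]
    rfl
  refine ⟨U, productOp_mul_conjTranspose hu, productOp_conjTranspose_mul hu', ?_, h0, h1, h2⟩
  rw [xyzBondHamiltonian₃, mul_neg, neg_mul, mul_sum, sum_mul]
  congr 1
  refine sum_congr rfl fun e _ => ?_
  induction e using Sym2.ind with
  | h x y =>
    rw [Sym2.lift_mk]
    show U * xyzBond₃ n a b c x y * Uᴴ = xyzBond₃ n a b c x y
    rw [xyzBond₃, mul_add, mul_add, add_mul, add_mul,
      mul_smul_comm, mul_smul_comm, mul_smul_comm, smul_mul_assoc, smul_mul_assoc, smul_mul_assoc,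
      hb0, hb1, hb2]

/-- **Mixed planar correlations vanish**: `ω_{H₃(a,b,c)}(Sʸ_x Sˣ_y) = 0` and
`ω_{H₃(a,b,c)}(Sˣ_x Sʸ_y) = 0` (the half turn about the first axis flips their sign).
[cite: BjornbergUeltschi2022, Proposition 2.4] -/
theorem xyz₃_groundStateFunctional_yx_eq_zero (a b c : ℝ) (x y : TorusSite d L) :
    (xyzBondHamiltonian₃ (d := d) L n a b c).groundStateFunctional (siteSpin n x 1 * siteSpin n y 0) = 0 ∧
    (xyzBondHamiltonian₃ (d := d) L n a b c).groundStateFunctional (siteSpin n x 0 * siteSpin n y 1) = 0 := by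
  obtain ⟨U, hU, hU', hH, h0, h1, -⟩ := exists_halfTurn_xyzBondHamiltonian₃ (d := d) L n a b c
  have key : ∀ O : Op (TorusSite d L) (n + 1),
      (xyzBondHamiltonian₃ (d := d) L n a b c).groundStateFunctional O =
        (xyzBondHamiltonian₃ (d := d) L n a b c).groundStateFunctional (U * O * Uᴴ) := by
    intro O
    conv_rhs => rw [← hH]
    rw [Matrix.groundStateFunctional_unitary_conj hU hU']
  have hmul : ∀ A B : Op (TorusSite d L) (n + 1), U * (A * B) * Uᴴ = (U * A * Uᴴ) * (U * B * Uᴴ) := by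
    intro A B
    simp only [mul_assoc]
    rw [← mul_assoc Uᴴ U, hU', one_mul]
  have neg_self : ∀ z : ℂ, z = -z → z = 0 := fun z hz => by
    have : (2 : ℂ) * z = 0 := by rw [two_mul]; nth_rewrite 2 [hz]; ring
    simpa using this
  refine ⟨neg_self _ ?_, neg_self _ ?_⟩
  · conv_lhs => rw [key, hmul, h1, h0, neg_mul, map_neg]
  · conv_lhs => rw [key, hmul, h0, h1, mul_neg, map_neg]

end HalfTurn

/-! ### `S⁺_x S⁻_y` in the tracial ground state of `H₃(1,1,Δ)` is twice `Sˣ_x Sˣ_y` -/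

section RaiseLower

variable {Λ : Type*} [Fintype Λ] [DecidableEq Λ] (n : ℕ)

/-- `S⁺_x S⁻_y = Sˣ_xSˣ_y + Sʸ_xSʸ_y + i (Sʸ_xSˣ_y - Sˣ_xSʸ_y)`. Tasaki (2020) §2.1, eq. (2.1.6).
[folklore] -/
theorem raise_mul_lower_eq (x y : Λ) :
    (onSite x (spinRaise n) * onSite y (spinLower n) : Op Λ (n + 1)) =
      siteSpin n x 0 * siteSpin n y 0 + siteSpin n x 1 * siteSpin n y 1 +
        I • (siteSpin n x 1 * siteSpin n y 0) - I • (siteSpin n x 0 * siteSpin n y 1) := by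
  rw [← LiebMattis.spinX_add_I_smul_spinY, ← LiebMattis.spinX_sub_I_smul_spinY, onSite_add', onSite_sub',
    onSite_smul', onSite_smul', siteSpin, siteSpin, siteSpin, siteSpin, spinVec_zero, spinVec_one]
  rw [add_mul, mul_sub, mul_sub, smul_mul_assoc, mul_smul_comm, mul_smul_comm, smul_mul_assoc, smul_smul,
    I_mul_I, neg_one_smul]
  abel

end RaiseLower

section Dictionary

variable {d : ℕ} (L : ℕ) [NeZero L] (n : ℕ)

/-- **`ω(S⁺_x S⁻_y) = 2 ω(Sˣ_x Sˣ_y)`** in the tracial ground state of the planar-symmetric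
`H₃(1,1,Δ)`: `ω(SʸSʸ) = ω(SˣSˣ)` by the quarter turn about the third axis
(`xyz₃_groundStateFunctional_swap`), and the mixed terms vanish
(`xyz₃_groundStateFunctional_yx_eq_zero`). [cite: BjornbergUeltschi2022, Proposition 2.4] -/
theorem xyz₃_groundStateFunctional_raiseLower (Δ : ℝ) (x y : TorusSite d L) :
    (xyzBondHamiltonian₃ (d := d) L n 1 1 Δ).groundStateFunctional
        (onSite x (spinRaise n) * onSite y (spinLower n)) =
      2 * (xyzBondHamiltonian₃ (d := d) L n 1 1 Δ).groundStateFunctional (siteSpin n x 0 * siteSpin n y 0) := by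
  obtain ⟨hxx, -, -⟩ := xyz₃_groundStateFunctional_swap (d := d) L n 1 1 Δ x y
  obtain ⟨hyx, hxy⟩ := xyz₃_groundStateFunctional_yx_eq_zero (d := d) L n 1 1 Δ x y
  rw [raise_mul_lower_eq, map_sub, map_add, map_add, map_smul, map_smul, hyx, hxy, ← hxx]
  simp only [smul_zero, add_zero, sub_zero]
  ring

end Dictionary


end Infrared

/-! ### The sector ground state as the tracial ground state; the kernel dictionary -/

section Sector

variable (M : ℕ) [NeZero M]

/-- **The vector state of a half-filled ground state is the tracial ground state**: for even
`M ≥ 4`, `Δ ≤ 0` and every normalised `S^z_tot = 0` sector ground state `ψ` of `H_M(Δ)`,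
`ω₀(O) = ⟨ψ, O ψ⟩` for every observable `O` (the ground space is the line `ℂψ`,
`xxzTorus_groundSpace_eq_span`; `groundStateFunctional_eq_of_hasUniqueGroundState`); the sector
hypothesis on `ψ` is not even needed, every ground vector being half filled.
Aizenman–Lieb–Seiringer–Solovej–Yngvason (2004) App. A; Tasaki (2020) §2.1. [folklore] -/
theorem sectorGS_expect_eq_groundStateFunctional (hM : Even M) (h4 : 4 ≤ M) {Δ : ℝ} (hΔ : Δ ≤ 0)
    (ψ : TensorIndex (TorusSite 2 M) 2 → ℂ) (hnorm : star ψ ⬝ᵥ ψ = 1)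
    (heig : Matrix.mulVec (xxzHamiltonian 1 (torusGraph 2 M) (-1) Δ) ψ =
      ((lowestEnergyInSector 1 (xxzHamiltonian 1 (torusGraph 2 M) (-1) Δ) 0 : ℝ) : ℂ) • ψ)
    (O : Op (TorusSite 2 M) 2) :
    (xxzHamiltonian 1 (torusGraph 2 M) (-1) Δ).groundStateFunctional O = star ψ ⬝ᵥ O *ᵥ ψ := by
  set H : Op (TorusSite 2 M) 2 := xxzHamiltonian 1 (torusGraph 2 M) (-1) Δ with hHdef
  obtain ⟨φ, hφ0, -, hspan, hEsec⟩ := xxzTorus_groundSpace_eq_span M hM h4 hΔ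
  have hψG : ψ ∈ H.groundSpace := by
    rw [mem_groundSpace_iff, ← hEsec]; exact heig
  have hψ0 : ψ ≠ 0 := fun h => by
    rw [h, dotProduct_zero] at hnorm
    exact zero_ne_one hnorm
  have hU : H.HasUniqueGroundState := by
    change Module.finrank ℂ H.groundSpace = 1
    rw [hspan]
    exact finrank_span_singleton hφ0
  rw [groundStateFunctional_eq_of_hasUniqueGroundState hU hψG hψ0, hnorm, div_one]

/-- **The transverse kernel is twice Björnberg–Ueltschi's first-component correlation of the
rotated frame**: `Re ⟨ψ, S⁺_x S⁻_y ψ⟩ = 2 · xyzGroundCorr 0 M 1 1 Δ x y` for every normalised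
half-filled ground state `ψ` of `H_M(Δ)`, even `M ≥ 4`, `Δ ≤ 0`.
[cite: BjornbergUeltschi2022, Proposition 2.4] -/
theorem transverseKernel_eq_two_mul_xyzGroundCorr (hM : Even M) (h4 : 4 ≤ M) {Δ : ℝ} (hΔ : Δ ≤ 0)
    (ψ : TensorIndex (TorusSite 2 M) 2 → ℂ) (hnorm : star ψ ⬝ᵥ ψ = 1)
    (heig : Matrix.mulVec (xxzHamiltonian 1 (torusGraph 2 M) (-1) Δ) ψ =
      ((lowestEnergyInSector 1 (xxzHamiltonian 1 (torusGraph 2 M) (-1) Δ) 0 : ℝ) : ℂ) • ψ)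
    (x y : TorusSite 2 M) :
    (star ψ ⬝ᵥ (onSite x (spinRaise 1) * onSite y (spinLower 1)) *ᵥ ψ).re =
      2 * xyzGroundCorr 0 M 1 1 Δ x y := by
  rw [← sectorGS_expect_eq_groundStateFunctional M hM h4 hΔ ψ hnorm heig,
    ← groundStateAxisCorrTorus_eq_xyzGroundCorr, ← re_groundStateFunctional_xx_eq_axisCorr,
    xxzTorus_eq_xyzBondHamiltonian₃, Infrared.xyz₃_groundStateFunctional_raiseLower,
    show (2 : ℂ) = ((2 : ℝ) : ℂ) by norm_num, re_ofReal_mul]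

/-- **Björnberg–Ueltschi's structure factor is half the Fourier transform of the transverse
kernel**: `xyzStructureFactor M 1 1 Δ q = ½ Σ_z cos(q·z) Re⟨ψ, S⁺_z S⁻_0 ψ⟩`, by
`transverseKernel_eq_two_mul_xyzGroundCorr` and translation invariance of the kernel
(`gs_transverseKernel_eq_sub`). [cite: BjornbergUeltschi2022, eq. (4.23)] -/
theorem xyzStructureFactor_eq_half_transverseHat (hM : Even M) (h4 : 4 ≤ M) {Δ : ℝ} (hΔ : Δ ≤ 0)
    (ψ : TensorIndex (TorusSite 2 M) 2 → ℂ)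
    (hψ : ψ ∈ @spinZSector (TorusSite 2 M) _ _ 1 0) (hnorm : star ψ ⬝ᵥ ψ = 1)
    (heig : Matrix.mulVec (xxzHamiltonian 1 (torusGraph 2 M) (-1) Δ) ψ =
      ((lowestEnergyInSector 1 (xxzHamiltonian 1 (torusGraph 2 M) (-1) Δ) 0 : ℝ) : ℂ) • ψ)
    (q : TorusSite 2 M) :
    xyzStructureFactor M 1 1 Δ q =
      (1 / 2 : ℝ) * ∑ z : TorusSite 2 M, Real.cos (torusPhase M q z) *
        (star ψ ⬝ᵥ (onSite z (spinRaise 1) * onSite 0 (spinLower 1)) *ᵥ ψ).re := by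
  set K : TorusSite 2 M → ℝ := fun z =>
    (star ψ ⬝ᵥ (onSite z (spinRaise 1) * onSite 0 (spinLower 1)) *ᵥ ψ).re with hK
  have hxy : ∀ x y : TorusSite 2 M, xyzGroundCorr 0 M 1 1 Δ x y = K (x - y) / 2 := by
    intro x y
    have h := transverseKernel_eq_two_mul_xyzGroundCorr M hM h4 hΔ ψ hnorm heig x y
    rw [gs_transverseKernel_eq_sub M hM Δ ψ hψ hnorm heig x y] at h
    simp only [hK]
    linarith
  have hM2 : (0 : ℝ) < (M : ℝ) ^ 2 := by
    have : (0 : ℝ) < (M : ℝ) := by exact_mod_cast Nat.pos_of_ne_zero (NeZero.ne M)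
    positivity
  rw [xyzStructureFactor_of_neZero]
  simp_rw [hxy]
  have hinner : ∀ x : TorusSite 2 M,
      ∑ y : TorusSite 2 M, Real.cos (torusPhase M q (x - y)) * (K (x - y) / 2) =
        ∑ z : TorusSite 2 M, Real.cos (torusPhase M q z) * (K z / 2) := fun x =>
    Equiv.sum_comp (Equiv.subLeft x) (fun z => Real.cos (torusPhase M q z) * (K z / 2))
  simp_rw [hinner]
  rw [sum_const, card_univ, card_torusSite, nsmul_eq_mul, Nat.cast_pow,
    mul_div_cancel_left₀ _ hM2.ne', mul_sum]
  refine sum_congr rfl fun z _ => ?_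
  simp only [hK]
  ring

end Sector

/-! ### A priori bound on the nearest-neighbour correlations of spin ½ -/

section BondBound

variable (M : ℕ) [NeZero M]

/-- `|cᵅ| ≤ ¼` for spin ½: the site- and direction-averaged nearest-neighbour correlation is an
average of numbers of modulus `≤ (½)²` (`xyzGroundCorr_abs_le`). [folklore] -/
theorem abs_xyzBondCorr_le_quarter (J₁ J₂ : ℝ) (α : Fin 3) :
    |xyzBondCorr (d := 2) α M 1 J₁ J₂| ≤ 1 / 4 := by
  have hM2 : (0 : ℝ) < (M : ℝ) ^ 2 := by
    have : (0 : ℝ) < (M : ℝ) := by exact_mod_cast Nat.pos_of_ne_zero (NeZero.ne M)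
    positivity
  have hden : (0 : ℝ) < (2 : ℕ) * (M : ℝ) ^ 2 := by positivity
  rw [xyzBondCorr_of_neZero, abs_div, abs_of_pos hden, div_le_iff₀ hden]
  calc |∑ x : TorusSite 2 M, ∑ i : Fin 2, xyzGroundCorr α M 1 J₁ J₂ x (x + Pi.single i 1)|
      ≤ ∑ x : TorusSite 2 M, ∑ i : Fin 2, |xyzGroundCorr α M 1 J₁ J₂ x (x + Pi.single i 1)| :=
        (abs_sum_le_sum_abs _ _).trans (sum_le_sum fun x _ => abs_sum_le_sum_abs _ _)
    _ ≤ ∑ x : TorusSite 2 M, ∑ i : Fin 2, (1 / 4 : ℝ) :=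
        sum_le_sum fun x _ => sum_le_sum fun i _ => by
          have h := xyzGroundCorr_abs_le M 1 J₁ J₂ α x (x + Pi.single i 1)
          norm_num at h
          exact h
    _ = 1 / 4 * ((2 : ℕ) * (M : ℝ) ^ 2) := by
        rw [sum_const, sum_const, card_univ, card_univ, card_torusSite, Fintype.card_fin, nsmul_eq_mul,
          nsmul_eq_mul]
        push_cast
        ring

end BondBound

/-! ### Input (a) of `stub_logBootstrap`: the infrared bound for the sector ground state -/

section Main

variable (M : ℕ) [NeZero M]

/-- **Input (a) of the log-bootstrap (crux `LevyTransport`, stmt-HubbardSuperconductivity-15049):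
the `M`-uniform `T = 0` infrared bound for the transverse kernel of the half-filled XXZ torus.**
For even `M ≥ 4`, every `Δ ≤ 0`, every normalised `S^z_tot = 0` sector ground state `ψ` of
`xxzHamiltonian 1 (torusGraph 2 M) (-1) Δ` and every dual momentum `q ≠ 0`: with
`K̂_ψ(q) = Σ_z cos(q·z) Re⟨ψ, S⁺_z S⁻_0 ψ⟩` and `E(q) = Σᵢ (1 - cos qᵢ)`,
`0 ≤ K̂_ψ(q)` and `K̂_ψ(q)² · E(q) ≤ 1 - Δ`. Reflection positivity ⇒ ground-state Gaussian
domination (`buSpinHalf_gaussianDomination`) ⇒ Björnberg–Ueltschi's Lemma 4.4 at `β = ∞`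
(`xyz_infraredBound_of_groundEnergy_le`), read through the sector/frame dictionary of this file.
[cite: BjornbergUeltschi2022, Lemma 4.4, Lemma 5.2, Cor. 5.3] [cite: KLS1988JSP, eqs. (17)–(19)] -/
theorem sectorGS_transverse_infraredBound (hM : Even M) (h4 : 4 ≤ M) {Δ : ℝ} (hΔ : Δ ≤ 0)
    (ψ : TensorIndex (TorusSite 2 M) 2 → ℂ)
    (hψ : ψ ∈ @spinZSector (TorusSite 2 M) _ _ 1 0) (hnorm : star ψ ⬝ᵥ ψ = 1)
    (heig : Matrix.mulVec (xxzHamiltonian 1 (torusGraph 2 M) (-1) Δ) ψ =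
      ((lowestEnergyInSector 1 (xxzHamiltonian 1 (torusGraph 2 M) (-1) Δ) 0 : ℝ) : ℂ) • ψ)
    (q : TorusSite 2 M) (hq : q ≠ 0) :
    0 ≤ ∑ z : TorusSite 2 M, Real.cos (torusPhase M q z) *
        (star ψ ⬝ᵥ (onSite z (spinRaise 1) * onSite 0 (spinLower 1)) *ᵥ ψ).re ∧
    (∑ z : TorusSite 2 M, Real.cos (torusPhase M q z) *
        (star ψ ⬝ᵥ (onSite z (spinRaise 1) * onSite 0 (spinLower 1)) *ᵥ ψ).re) ^ 2 *
      dispersion (latticeMomentum M q) ≤ 1 - Δ := by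
  set Khat : ℝ := ∑ z : TorusSite 2 M, Real.cos (torusPhase M q z) *
    (star ψ ⬝ᵥ (onSite z (spinRaise 1) * onSite 0 (spinLower 1)) *ᵥ ψ).re with hKhat
  -- Gaussian domination for `H' = H(1, Δ, 1)` and B–U's Lemma 4.4 at `β = ∞`
  have hGD : ∀ h : TorusSite 2 M → ℝ,
      (anisotropicTorus 2 M 1 1 Δ 1).groundEnergy ≤
        (anisotropicTorus 2 M 1 1 Δ 1 - (2 : ℂ) • xyGradField M 1 h +
          ((xyFieldEnergy M h : ℝ) : ℂ) • 1).groundEnergy := fun h =>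
    buSpinHalf_gaussianDomination M 1 hM h4 zero_le_one hΔ h
  obtain ⟨hg0, hIR⟩ := xyz_infraredBound_of_groundEnergy_le M 1 1 Δ (by omega) (by norm_num) hGD q hq
  have hhalf : xyzStructureFactor M 1 1 Δ q = (1 / 2 : ℝ) * Khat :=
    xyzStructureFactor_eq_half_transverseHat M hM h4 hΔ ψ hψ hnorm heig q
  rw [hhalf] at hg0 hIR
  refine ⟨by linarith, ?_⟩
  -- the right-hand side of Lemma 4.4 is at most `(1 - Δ)/4`
  set c1 : ℝ := xyzBondCorr (d := 2) 1 M 1 1 Δ with hc1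
  set c2 : ℝ := xyzBondCorr (d := 2) 2 M 1 1 Δ with hc2
  have hb1 : |c1| ≤ 1 / 4 := abs_xyzBondCorr_le_quarter M 1 Δ 1
  have hb2 : |c2| ≤ 1 / 4 := abs_xyzBondCorr_le_quarter M 1 Δ 2
  have hterm : ∀ i : Fin 2,
      (Δ * c1 + 1 * c2) - (1 * c1 + Δ * c2) * Real.cos (latticeMomentum M q i) ≤ (1 - Δ) / 2 := by
    intro i
    set cs : ℝ := Real.cos (latticeMomentum M q i)
    have hcs : |cs| ≤ 1 := Real.abs_cos_le_one _
    have t1 : Δ * c1 ≤ -Δ / 4 := by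
      calc Δ * c1 ≤ |Δ * c1| := le_abs_self _
        _ = |Δ| * |c1| := abs_mul _ _
        _ ≤ |Δ| * (1 / 4) := mul_le_mul_of_nonneg_left hb1 (abs_nonneg _)
        _ = -Δ / 4 := by rw [abs_of_nonpos hΔ]; ring
    have t2 : c2 ≤ 1 / 4 := (le_abs_self _).trans hb2
    have t3 : -((1 * c1 + Δ * c2) * cs) ≤ 1 / 4 - Δ / 4 := by
      calc -((1 * c1 + Δ * c2) * cs) ≤ |(1 * c1 + Δ * c2) * cs| := neg_le_abs _
        _ = |1 * c1 + Δ * c2| * |cs| := abs_mul _ _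
        _ ≤ |1 * c1 + Δ * c2| * 1 := mul_le_mul_of_nonneg_left hcs (abs_nonneg _)
        _ ≤ |1 * c1| + |Δ * c2| := by rw [mul_one]; exact abs_add_le _ _
        _ = |c1| + |Δ| * |c2| := by rw [one_mul, abs_mul]
        _ ≤ 1 / 4 + |Δ| * (1 / 4) := add_le_add hb1 (mul_le_mul_of_nonneg_left hb2 (abs_nonneg _))
        _ = 1 / 4 - Δ / 4 := by rw [abs_of_nonpos hΔ]; ring
    linarith
  have hsum : ∑ i : Fin 2,
      ((Δ * c1 + 1 * c2) - (1 * c1 + Δ * c2) * Real.cos (latticeMomentum M q i)) ≤ 1 - Δ := by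
    calc ∑ i : Fin 2, ((Δ * c1 + 1 * c2) - (1 * c1 + Δ * c2) * Real.cos (latticeMomentum M q i))
        ≤ ∑ _i : Fin 2, (1 - Δ) / 2 := sum_le_sum fun i _ => hterm i
      _ = 1 - Δ := by rw [sum_const, card_univ, Fintype.card_fin, nsmul_eq_mul]; push_cast; ring
  have hE : 0 ≤ dispersion (latticeMomentum M q) := dispersion_nonneg _
  nlinarith [hIR, hsum, hE]

/-- **Input (a) on the route's interval**, `∀`-closed: for even `M ≥ 4`, `Δ ∈ [-1, 0]`, every
normalised half-filled sector ground state `ψ` of `H_M(Δ)` and every `q ≠ 0`,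
`0 ≤ K̂_ψ(q)` and `K̂_ψ(q)² · Σᵢ(1 - cos qᵢ) ≤ 2` — the Gaussian-domination infrared bound with
a constant uniform in `M` AND in `Δ ∈ [-1, 0]`, as consumed by the log-bootstrap
(`stub_logBootstrap`, input (a)). [cite: BjornbergUeltschi2022, Lemma 4.4 and Cor. 5.3] -/
theorem sectorGS_transverse_infraredBound_uniform :
    ∀ (M : ℕ) [NeZero M], Even M → 4 ≤ M → ∀ Δ ∈ Set.Icc (-1 : ℝ) 0,
      ∀ (ψ : TensorIndex (TorusSite 2 M) 2 → ℂ),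
      ψ ∈ @spinZSector (TorusSite 2 M) _ _ 1 0 → star ψ ⬝ᵥ ψ = 1 →
      Matrix.mulVec (xxzHamiltonian 1 (torusGraph 2 M) (-1) Δ) ψ =
        ((lowestEnergyInSector 1 (xxzHamiltonian 1 (torusGraph 2 M) (-1) Δ) 0 : ℝ) : ℂ) • ψ →
      ∀ q : TorusSite 2 M, q ≠ 0 →
        0 ≤ ∑ z : TorusSite 2 M, Real.cos (torusPhase M q z) *
            (star ψ ⬝ᵥ (onSite z (spinRaise 1) * onSite 0 (spinLower 1)) *ᵥ ψ).re ∧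
        (∑ z : TorusSite 2 M, Real.cos (torusPhase M q z) *
            (star ψ ⬝ᵥ (onSite z (spinRaise 1) * onSite 0 (spinLower 1)) *ᵥ ψ).re) ^ 2 *
          dispersion (latticeMomentum M q) ≤ 2 := by
  intro M _ hM h4 Δ hΔ ψ hψ hnorm heig q hq
  obtain ⟨h0, h1⟩ := sectorGS_transverse_infraredBound M hM h4 hΔ.2 ψ hψ hnorm heig q hq
  exact ⟨h0, h1.trans (by linarith [hΔ.1])⟩

end Main

end Summit.HubbardSuperconductivity.HubbardSuperconductivity.Theorems.LevyLogBootstrap
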